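import Summits.BirchSwinnertonDyer.BirchSwinnertonDyer.Theorems.ManinLocalTwoThreeGenerationCocycleHecke
import HarnessLib

/-!
# Route `ManinLocalTwoThree`, crux C3 `ManinPrimeToThreeAtNine` (stmt-BirchSwinnertonDyer-22968): the generation stub
# `stub_shiftClass_generation` = E-es-19 `ShiftClassGenerationThree` FROM the cell's relative Ihara statement E-es-25 at
# `(p,t,n) = (3,3,1)` (typer g4's typed shift form `RelativeIharaShiftVanishing 3 3 1`, HOME/typer, body inlined — not yet a
# tree constant) AND the non-Eisenstein property of `ℓ ↦ a_ℓ(W) mod 3` for `W[3]` irreducible (line prover p3; CONDITIONAL)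

The composition of the landed bridges: `shiftClassGenerationThree_iff_functionals` (lattice Nakayama),
`functionalCocycle_mem_cocycles` + `isHeckeGenEigenvector_functionalCocycle` (the cocycle `u_φ(γ) = φ({∞, γ∞}_f)` is a
Hecke eigen-cocycle for `a_ℓ(W)`), and shift-invariance of `u_φ` on `Γ₀(N·3)` from `φ(Λ_{f∣ι₃ − f∣ι₁}) = 0`
(`periodLattice_shiftOldform_eq_closure_columns`: the conjugates `diag(3,1)γdiag(3,1)⁻¹`, `γ` have second columns
`(3b, e)`, `(b, e)`).  Hypotheses, both NOT proved here and NOT asserted: `hRI` = E-es-25(3,3,1) verbatim in the typer's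
cocycle currency (MEMO-es §21; a theorem-candidate with a proof sketch, refereeing R-es-21 pending), `hNE` = «`W[3]`
irreducible ⟹ `ℓ ↦ a_ℓ(W) mod 3` is not narrow-Eisenstein» (Brauer–Nesbitt–Chebotarev; to be cited as a Literature
fact).  Nothing about BSD or Manin's conjecture is proved here; E-es-19 is proved only under `hRI ∧ hNE`.
-/

set_option autoImplicit false
set_option linter.dupNamespace false

noncomputable section

open scoped Classical MatrixGroups ModularForm BigOperators

open CongruenceSubgroup Matrix.SpecialLinearGroup ModularGroup
  Literature.NumberTheory.EllipticCurves Literature.NumberTheory.EllipticCurves.ModularForms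
  Literature.NumberTheory.EllipticCurves.ModularForms.HidaCohomology
  Summit.BirchSwinnertonDyer.Rank1Residual.ManinAdditive

namespace Summit.BirchSwinnertonDyer.BirchSwinnertonDyer.Theorems.ManinLocalTwoThree

/-- **E-es-19 ⟸ E-es-25(3,3,1) ∧ (non-Eisenstein at 3).** `hRI` is the typer's `RelativeIharaShiftVanishing 3 3 1`
verbatim: every `λ`-generalised Hecke eigen-cocycle `u ∈ Hom(Γ₀(L), K)` (`char K = 3`, `λ` not narrow-Eisenstein of
weight 2, `S ⊇` primes of `9L`) with `π₃^* u = π₁^* u` on `Γ₀(3L)` vanishes; `hNE`: for `W[3]` irreducible the system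
`ℓ ↦ a_ℓ(W) mod 3` is not narrow-Eisenstein. Then `ShiftClassGenerationThree`. [folklore] -/
theorem shiftClassGenerationThree_of_relativeIhara
    (hRI : ∀ (K : Type) [Field K] [CharP K 3] (L : ℕ) [NeZero L] [NeZero (3 : ℕ)] (S : Finset ℕ) (lam : ℕ → K)
      (u : cocycles 0 L K),
      (∀ q : ℕ, q.Prime → q ∣ 3 * 3 * L → q ∈ S) →
      IsHeckeGenEigenvector S lam u →
      ¬ IsNarrowEisensteinEigensystem 2 lam →
      degeneracyPullback 0 L (L * 3 ^ 1) (3 ^ 1) K dvd_rfl (u : Gamma0 L → Fin 1 → K) =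
        degeneracyPullback 0 L (L * 3 ^ 1) 1 K (by simp) (u : Gamma0 L → Fin 1 → K) →
      u = 0)
    (hNE : ∀ (W : WeierstrassCurve ℚ) [W.IsElliptic], W.HasIrreducibleModPGaloisRep 3 →
      ¬ IsNarrowEisensteinEigensystem 2 (fun ℓ : ℕ => ((W.LFunction ℓ : ℤ) : ZMod 3))) :
    ShiftClassGenerationThree := by
  haveI : Fact (Nat.Prime 3) := ⟨Nat.prime_three⟩
  rw [shiftClassGenerationThree_iff_functionals]
  intro W _ N _ f hf h9 hirr φ hφ
  have hN0 : 0 < N := Nat.pos_of_ne_zero (NeZero.ne N)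
  have h9' : 9 ∣ N := by norm_num at h9; exact h9
  have h3 : 3 ∣ N := dvd_trans (by norm_num) h9'
  -- the functional cocycle `u_φ`
  set u : cocycles 0 N (ZMod 3) :=
    ⟨fun (γ : Gamma0 N) (_ : Fin 1) => φ ⟨cuspSymbol f γ, cuspSymbol_mem_periodLattice f γ⟩,
      functionalCocycle_mem_cocycles f φ⟩ with hu
  set S : Finset ℕ := (3 * 3 * N).primeFactors with hS
  have hSmem : ∀ q : ℕ, q.Prime → q ∣ 3 * 3 * N → q ∈ S := fun q hq hqd =>
    (Nat.mem_primeFactors_of_ne_zero (by positivity)).mpr ⟨hq, hqd⟩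
  have hgen : IsHeckeGenEigenvector S (fun ℓ : ℕ => ((W.LFunction ℓ : ℤ) : ZMod 3)) u :=
    isHeckeGenEigenvector_functionalCocycle hf φ S
  -- shift-invariance on `Γ₀(N·3)`: the conjugates have second columns `(3b, e)` and `(b, e)`
  have hshift : degeneracyPullback 0 N (N * 3 ^ 1) (3 ^ 1) (ZMod 3) dvd_rfl (u : Gamma0 N → Fin 1 → ZMod 3) =
      degeneracyPullback 0 N (N * 3 ^ 1) 1 (ZMod 3) (by simp) (u : Gamma0 N → Fin 1 → ZMod 3) := by
    funext γ i
    rw [degeneracyPullback_zero_apply, degeneracyPullback_one_apply]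
    show φ ⟨cuspSymbol f (Gamma0.degeneracyConj N (N * 3 ^ 1) (3 ^ 1) dvd_rfl γ), _⟩ =
      φ ⟨cuspSymbol f (Gamma0.degeneracyConj N (N * 3 ^ 1) 1 (by simp) γ), _⟩
    rw [← sub_eq_zero, ← map_sub]
    apply hφ
    have hL : 1 < N * 3 ^ 1 := by omega
    have he : ((γ : SL(2, ℤ)) 1 1 : ℤ) ≠ 0 := apply_one_one_ne_zero_of_one_lt hL γ
    have h11₃ : ((Gamma0.degeneracyConj N (N * 3 ^ 1) (3 ^ 1) dvd_rfl γ : SL(2, ℤ)) 1 1 : ℤ) =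
        (γ : SL(2, ℤ)) 1 1 := rfl
    have h01₃ : ((Gamma0.degeneracyConj N (N * 3 ^ 1) (3 ^ 1) dvd_rfl γ : SL(2, ℤ)) 0 1 : ℤ) =
        ((3 ^ 1 : ℕ) : ℤ) * (γ : SL(2, ℤ)) 0 1 := rfl
    have h11₁ : ((Gamma0.degeneracyConj N (N * 3 ^ 1) 1 (by simp) γ : SL(2, ℤ)) 1 1 : ℤ) =
        (γ : SL(2, ℤ)) 1 1 := rfl
    have h01₁ : ((Gamma0.degeneracyConj N (N * 3 ^ 1) 1 (by simp) γ : SL(2, ℤ)) 0 1 : ℤ) =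
        ((1 : ℕ) : ℤ) * (γ : SL(2, ℤ)) 0 1 := rfl
    show cuspSymbol f _ - cuspSymbol f _ ∈ _
    rw [cuspSymbol_eq_modularSymbol_div_sub f _ (by rw [h11₃]; exact he),
      cuspSymbol_eq_modularSymbol_div_sub f _ (by rw [h11₁]; exact he), h11₃, h01₃, h11₁, h01₁,
      periodLattice_shiftOldform_eq_closure_columns f h3]
    apply AddSubgroup.subset_closure
    refine ⟨((γ : SL(2, ℤ)) 0 1 : ℤ), ((γ : SL(2, ℤ)) 1 1 : ℤ), he, ?_, ?_⟩
    · have hN' : IsCoprime ((γ : SL(2, ℤ)) 1 1 : ℤ) ((N * 3 ^ 1 : ℕ) : ℤ) := isCoprime_apply_one_one_level γ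
      push_cast at hN'
      exact (hN'.of_mul_right_left).mul_right (isCoprime_apply_zero_one_apply_one_one γ).symm
    · push_cast
      ring_nf
  have hu0 : u = 0 := hRI (ZMod 3) N S _ u hSmem hgen (hNE W hirr) hshift
  -- `u_φ = 0` forces `φ = 0`
  ext x
  have hx : (x : ℂ) ∈ (periodLattice f : Set ℂ) := x.2
  rw [coe_periodLattice_eq_range] at hx
  obtain ⟨γ, hγ⟩ := hx
  have hxγ : x = ⟨cuspSymbol f γ, cuspSymbol_mem_periodLattice f γ⟩ := Subtype.ext hγ.symm
  have h0 : (u : Gamma0 N → Fin 1 → ZMod 3) γ 0 = 0 := by rw [hu0]; rfl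
  rw [hxγ, AddMonoidHom.zero_apply]
  exact h0

/-- **The per-curve core at `p = 3`**: for a `W`-newform `f` with `9 ∣ N` and an additive `φ : Λ_f → 𝔽₃` killing
`Λ_{f∣ι₃ − f∣ι₁}`, if every Hecke-generalised eigen-cocycle `u ∈ Hom(Γ₀(N), 𝔽₃)` for the system `ℓ ↦ a_ℓ(W)` (away from
any `S ⊇ primes(9N)`) with `π₃^* u = π₁^* u` on `Γ₀(3N)` vanishes, then `φ = 0` — the single-shift relative Ihara
conclusion SPECIALISED to `(K, L, λ) = (𝔽₃, N, a_•(W))`, with no Eisenstein hypothesis (the caller discharges it).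
Proof = the body of `shiftClassGenerationThree_of_relativeIhara`. [folklore] -/
theorem functional_eq_zero_of_shiftVanishing_three {W : WeierstrassCurve ℚ} [W.IsElliptic] {N : ℕ} [NeZero N]
    {f : CuspForm (Gamma0 N) 2} (hf : IsNewformOf W f) (h9 : 3 ^ 2 ∣ N) (φ : ↥(periodLattice f) →+ ZMod 3)
    (hφ : ∀ x : ↥(periodLattice f), (x : ℂ) ∈
      periodLattice (degeneracyMap0 N (3 * N) 3 2 f - degeneracyMap0 N (3 * N) 1 2 f) → φ x = 0)
    (hvan : ∀ (S : Finset ℕ) (u : cocycles 0 N (ZMod 3)),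
      (∀ q : ℕ, q.Prime → q ∣ 3 * 3 * N → q ∈ S) →
      IsHeckeGenEigenvector S (fun ℓ : ℕ => ((W.LFunction ℓ : ℤ) : ZMod 3)) u →
      degeneracyPullback 0 N (N * 3 ^ 1) (3 ^ 1) (ZMod 3) dvd_rfl (u : Gamma0 N → Fin 1 → ZMod 3) =
        degeneracyPullback 0 N (N * 3 ^ 1) 1 (ZMod 3) (by simp) (u : Gamma0 N → Fin 1 → ZMod 3) →
      u = 0) :
    φ = 0 := by
  have hN0 : 0 < N := Nat.pos_of_ne_zero (NeZero.ne N)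
  have h9' : 9 ∣ N := by norm_num at h9; exact h9
  have h3 : 3 ∣ N := dvd_trans (by norm_num) h9'
  set u : cocycles 0 N (ZMod 3) :=
    ⟨fun (γ : Gamma0 N) (_ : Fin 1) => φ ⟨cuspSymbol f γ, cuspSymbol_mem_periodLattice f γ⟩,
      functionalCocycle_mem_cocycles f φ⟩ with hu
  set S : Finset ℕ := (3 * 3 * N).primeFactors with hS
  have hSmem : ∀ q : ℕ, q.Prime → q ∣ 3 * 3 * N → q ∈ S := fun q hq hqd =>
    (Nat.mem_primeFactors_of_ne_zero (by positivity)).mpr ⟨hq, hqd⟩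
  have hgen : IsHeckeGenEigenvector S (fun ℓ : ℕ => ((W.LFunction ℓ : ℤ) : ZMod 3)) u :=
    isHeckeGenEigenvector_functionalCocycle hf φ S
  have hshift : degeneracyPullback 0 N (N * 3 ^ 1) (3 ^ 1) (ZMod 3) dvd_rfl (u : Gamma0 N → Fin 1 → ZMod 3) =
      degeneracyPullback 0 N (N * 3 ^ 1) 1 (ZMod 3) (by simp) (u : Gamma0 N → Fin 1 → ZMod 3) := by
    funext γ i
    rw [degeneracyPullback_zero_apply, degeneracyPullback_one_apply]
    show φ ⟨cuspSymbol f (Gamma0.degeneracyConj N (N * 3 ^ 1) (3 ^ 1) dvd_rfl γ), _⟩ =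
      φ ⟨cuspSymbol f (Gamma0.degeneracyConj N (N * 3 ^ 1) 1 (by simp) γ), _⟩
    rw [← sub_eq_zero, ← map_sub]
    apply hφ
    have hL : 1 < N * 3 ^ 1 := by omega
    have he : ((γ : SL(2, ℤ)) 1 1 : ℤ) ≠ 0 := apply_one_one_ne_zero_of_one_lt hL γ
    have h11₃ : ((Gamma0.degeneracyConj N (N * 3 ^ 1) (3 ^ 1) dvd_rfl γ : SL(2, ℤ)) 1 1 : ℤ) =
        (γ : SL(2, ℤ)) 1 1 := rfl
    have h01₃ : ((Gamma0.degeneracyConj N (N * 3 ^ 1) (3 ^ 1) dvd_rfl γ : SL(2, ℤ)) 0 1 : ℤ) =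
        ((3 ^ 1 : ℕ) : ℤ) * (γ : SL(2, ℤ)) 0 1 := rfl
    have h11₁ : ((Gamma0.degeneracyConj N (N * 3 ^ 1) 1 (by simp) γ : SL(2, ℤ)) 1 1 : ℤ) =
        (γ : SL(2, ℤ)) 1 1 := rfl
    have h01₁ : ((Gamma0.degeneracyConj N (N * 3 ^ 1) 1 (by simp) γ : SL(2, ℤ)) 0 1 : ℤ) =
        ((1 : ℕ) : ℤ) * (γ : SL(2, ℤ)) 0 1 := rfl
    show cuspSymbol f _ - cuspSymbol f _ ∈ _
    rw [cuspSymbol_eq_modularSymbol_div_sub f _ (by rw [h11₃]; exact he),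
      cuspSymbol_eq_modularSymbol_div_sub f _ (by rw [h11₁]; exact he), h11₃, h01₃, h11₁, h01₁,
      periodLattice_shiftOldform_eq_closure_columns f h3]
    apply AddSubgroup.subset_closure
    refine ⟨((γ : SL(2, ℤ)) 0 1 : ℤ), ((γ : SL(2, ℤ)) 1 1 : ℤ), he, ?_, ?_⟩
    · have hN' : IsCoprime ((γ : SL(2, ℤ)) 1 1 : ℤ) ((N * 3 ^ 1 : ℕ) : ℤ) := isCoprime_apply_one_one_level γ
      push_cast at hN'
      exact (hN'.of_mul_right_left).mul_right (isCoprime_apply_zero_one_apply_one_one γ).symm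
    · push_cast
      ring_nf
  have hu0 : u = 0 := hvan S u hSmem hgen hshift
  ext x
  have hx : (x : ℂ) ∈ (periodLattice f : Set ℂ) := x.2
  rw [coe_periodLattice_eq_range] at hx
  obtain ⟨γ, hγ⟩ := hx
  have hxγ : x = ⟨cuspSymbol f γ, cuspSymbol_mem_periodLattice f γ⟩ := Subtype.ext hγ.symm
  have h0 : (u : Gamma0 N → Fin 1 → ZMod 3) γ 0 = 0 := by rw [hu0]; rfl
  rw [hxγ, AddMonoidHom.zero_apply]
  exact h0

/-- **E-es-19 ⟸ E-es-25-Bar(3,3,1) ∧ its Eisenstein residual** (planner es g10, MEMO-es §22 / P-es-4: the OFFICIAL E-es-25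
is `EsG10.RelativeIharaShiftVanishingBar p t n` — the typer's single-shift form with hypothesis 3 read with TWO characters
over `K̄`, `¬ IsEisensteinEigensystem 2 (algebraMap K K̄ ∘ λ)`). `hRI` is the body of `RelativeIharaShiftVanishingBar 3 3 1`
VERBATIM. `hRes` is E-es-19 in functional form for the RESIDUAL curves: `9 ∣ N`, `W[3]` irreducible, yet `ℓ ↦ a_ℓ(W) mod 3`
IS Eisenstein over `𝔽̄₃` (this happens exactly when `ρ̄_{W,3}` is irreducible but not absolutely irreducible, i.e. has image
in a nonsplit Cartan subgroup: then `a_ℓ ≡ ψ(ℓ) + ψ(ℓ)³`); for all other curves NO curve-side Galois fact is needed — the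
non-Eisenstein hypothesis of `hRI` is discharged by the case split itself. [folklore] -/
theorem shiftClassGenerationThree_of_relativeIharaBar
    (hRI : ∀ (K : Type) [Field K] [CharP K 3] (L : ℕ) [NeZero L] [NeZero (3 : ℕ)] (S : Finset ℕ) (lam : ℕ → K)
      (u : cocycles 0 L K),
      (∀ q : ℕ, q.Prime → q ∣ 3 * 3 * L → q ∈ S) →
      IsHeckeGenEigenvector S lam u →
      ¬ IsEisensteinEigensystem 2 (fun ℓ => algebraMap K (AlgebraicClosure K) (lam ℓ)) →
      degeneracyPullback 0 L (L * 3 ^ 1) (3 ^ 1) K dvd_rfl (u : Gamma0 L → Fin 1 → K) =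
        degeneracyPullback 0 L (L * 3 ^ 1) 1 K (by simp) (u : Gamma0 L → Fin 1 → K) →
      u = 0)
    (hRes : ∀ (W : WeierstrassCurve ℚ) [W.IsElliptic] {N : ℕ} [NeZero N] (f : CuspForm (Gamma0 N) 2),
      IsNewformOf W f → 3 ^ 2 ∣ N → W.HasIrreducibleModPGaloisRep 3 →
      IsEisensteinEigensystem 2
        (fun ℓ : ℕ => algebraMap (ZMod 3) (AlgebraicClosure (ZMod 3)) ((W.LFunction ℓ : ℤ) : ZMod 3)) →
      ∀ φ : ↥(periodLattice f) →+ ZMod 3,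
        (∀ x : ↥(periodLattice f), (x : ℂ) ∈
            periodLattice (degeneracyMap0 N (3 * N) 3 2 f - degeneracyMap0 N (3 * N) 1 2 f) → φ x = 0) →
        φ = 0) :
    ShiftClassGenerationThree := by
  rw [shiftClassGenerationThree_iff_functionals]
  intro W _ N _ f hf h9 hirr φ hφ
  by_cases hE : IsEisensteinEigensystem 2
      (fun ℓ : ℕ => algebraMap (ZMod 3) (AlgebraicClosure (ZMod 3)) ((W.LFunction ℓ : ℤ) : ZMod 3))
  · exact hRes W f hf h9 hirr hE φ hφ
  · exact functional_eq_zero_of_shiftVanishing_three hf h9 φ hφ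
      fun S u hS hgen hshift => hRI (ZMod 3) N S _ u hS hgen hE hshift

end Summit.BirchSwinnertonDyer.BirchSwinnertonDyer.Theorems.ManinLocalTwoThree

end
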